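import Literature.MathematicalPhysics.QuantumFieldTheory.Balaban1983to89.Node00.OpsYRecordV11H

/-!
# NODE 00 · def-Y — `OpsYRecordV11SH`: the HÖLDER transporter injected at the operator layer's `G′` SLOT (CASCADE-K K0, edition 3)

Referee ref-E g40 READ-3 (✓p776717 `OpsYRecordV11H`) raised ⚑ DESIGN-FLAG K0-H-P349: the letters-to-operators constructors read the ONE site-transporter
letter `𝔏.parS` in TWO roles —

* as the HÖLDER transporter of (3.43)∕(3.45) (the `par` argument of `kernelFamilyS` in the `G′` slot `Gp` of `operatorLayerYOfLetters`), and
* as the AVERAGING transporter (contours (3.21)) inside `R(U)` of (3.49), `P = I − R`: the `P349` slot `p349SiteY … 𝔏 = fineKernelOfSiteOp … (P349Y x 𝔏.parS 𝔏.Gp)`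
  of the site-(3.49) layer `operatorLayerYS349` (and, outside the operator layer, by the Thm 3.9 ∕ Thm 3.11 readings `L39 … 𝔏.parS 𝔏.Gp`, `CY … 𝔏.parS 𝔏.Gp`).

So resetting the LETTER (`lettersYOfRecordV11[K]H`, edition 2) moves BOTH slots: `(opsYNuStOfRecordV11KHE … x).P349` reads `P349Y x (parSymY x) (G′(parKnitY x))` — the
shortest-contour transporter inside the averaging `R(U)` (`opsYNuStOfRecordV11KHE_P349` below records this, `rfl`). THIS EDITION keeps the v11 letters of record
UNCHANGED (`lettersYOfRecordV11[K]`: `parS := parKnitY`, the averaging contours, read as such by `P349`, Thm 3.9, Thm 3.11) and injects the Hölder transporter where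
and only where the operator layer reads it — the `par` argument of `kernelFamilyS` in the `G′` slot:

* §1 `opsYS349OfLettersH ∕ opsYS349NuOfLettersH N θ M⋆ 𝔏 parH 𝔈 := fun x => { opsYS349[Nu]OfLetters N θ M⋆ 𝔏 𝔈 x with Gp := kernelFamilyS … (𝔏 x).Gp (parH x) }`
  — PARAMETRIC ONCE in the Hölder transporter family `parH`; every other field is the site-(3.49) [+ `ν`] layer's (`rfl` faces); the DIAGONAL instance
  `parH := fun x => (𝔏 x).parS` IS `opsYS349[Nu]OfLetters` (`rfl`).
* §2 the records `opsY[Nu]StOfRecordV11ESH N θ M⋆ 𝔮 𝔮⋆ h𝔮 h𝔮⋆ 𝔯 parH 𝔢 𝔴 𝔈 := opsYSectESt … (opsYS349[Nu]OfLettersH … (lettersYOfRecordV11 …) parH 𝔈) (lettersYOfRecordV11 …) 𝔢 𝔴`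
  and the KNIT INSTANCES OF RECORD `opsY[Nu]StOfRecordV11KSE N θ M⋆ 𝔯 𝔢 𝔴 𝔈` := the same at the knit pair `(qKnitOfRecord, qsKnitOfRecord)` and `parH := parSymY`
  (print's shortest contours (3.40)); off the `G′` slot they ARE the v11 instances `opsY[Nu]StOfRecordV11[K]E` field by field (`rfl`).
* §3 the pins a K3 knit certificate displays, ALL `rfl` at the knit instance of record: `hGpPin` — `kernelFamilyR R₁ R₂ (… x).Gp = kernelFamilyS … (G′(parKnitY x)) (parSymY x)`
  (split shape `(parA, parH) = (parKnitY, parSymY)` of `B9LeafXCodedKnitUPar` ∕ `KSCUPar` ∕ `carriersYUParH`); `hGAPin` — `G[𝔮](parKnitY, G′)` with `parBY`; `hCinvPin` —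
  `C(U; parKnitY, G′(parKnitY))`; AND the (3.49) slot `P349 = fineKernelOfSiteOp … (P349Y x (parKnitY x) (G′(parKnitY x)))` — the averaging transporter inside `R(U)`.

HONEST STATUS. Definitions by structure update + `rfl` faces; nothing of [B9] Thms 3.1–3.15 is proved here; which instance a knit certificate pins is the knit
desk's call (dag-n06-d) — this file only makes the instance with BOTH transporter roles at print's values available by name. Edition 2 (`OpsYRecordV11H`) stays
as landed (its statements are true); it is not the object these pins recommend. The Sect.-E exponent record's own Hölder reading (the `E37` residual family
`kernelFamilyS … 𝔏.Gp 𝔏.parS` of `OpsYExpsOfRecordV3`) is the exponent record's binder, not this file's. COUNT unchanged; count-neutral helper.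

Sources: [Balaban1985BackgroundPropagators] T. Bałaban, Commun. Math. Phys. 99 (1985) 389–434 — (3.21) p.393, (3.40)–(3.45) pp.397–398, (3.48)–(3.49) pp.398–399,
(3.115) p.418; [Balaban1985Averaging] T. Bałaban, Commun. Math. Phys. 98 (1985) 17–51 — (15) p.19, Prop. 2 p.26.
-/

namespace Literature.MathematicalPhysics.QuantumFieldTheory.Balaban1983to89.Node00

open B6Ineq2142KLevelV1 (β)
open B6KLevelCensusIndexV1 (KIdx)
open B9PinMembersKLevelV1 (MemberY geo9Y bg9Y)
open B9BackgroundsKLevelV1R (RegFamY bg9YR kernelFamilyR siteKernelR)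
open B7Prop2SpecialUnitary (specialUnitaryUnits)
open B9B8AveragingJunction (parKnitY parKnitY_one)
open B9Ineq349SiteReading (p349SiteY fineKernelOfSiteOp opsYS349OfLetters)
open B9Eq3132NuReading (opsYS349NuOfLetters)
open OpsYQLetter (QLetterY QsLetterY QFamY QsFamY qKnitOfRecord qsKnitOfRecord)
open scoped Matrix

noncomputable section

/-! ## §1 The site-(3.49) [+ `ν`] operator layers with the Hölder transporter injected at the `G′` slot -/

section Constructors

open scoped Matrix.Norms.L2Operator

variable {N : ℕ} {θ : Stage3Params} {Mstar : ℕ}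

/-- ★★★ **THE SITE-(3.49) OPERATOR LAYER OF A LETTERS FAMILY WITH THE HÖLDER TRANSPORTER `parH` IN THE `G′` SLOT**: `opsYS349OfLetters N θ M⋆ 𝔏 𝔈` with
`Gp := kernelFamilyS … (𝔏 x).Gp (parH x)` — the sup∕Hölder readings (3.41)–(3.45) of the letter `G′` with Hölder transporter `parH x`; every other slot
(in particular `P349 = I − R(U)` over the AVERAGING transporter `(𝔏 x).parS`) unchanged.
[cite: Balaban1985BackgroundPropagators, Thm 3.1 (3.41)–(3.45) pp.397–398, (3.49) p.399] -/
def opsYS349OfLettersH (N : ℕ) (θ : Stage3Params) (Mstar : ℕ) (𝔏 : LettersY N θ Mstar)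
    (parH : ∀ x : MemberY θ.d₆ θ.ℓ₆ θ.hd' θ.hL' θ.b₀ θ.b₁ Mstar, SiteParY (Matrix (Fin N) (Fin N) ℂ) x.toKIdx) (𝔈 : ExpsY N θ Mstar) :
    OpsY N θ Mstar :=
  fun x => { opsYS349OfLetters N θ Mstar 𝔏 𝔈 x with
    Gp := kernelFamilyS x.toKIdx (bg9Y (Matrix (Fin N) (Fin N) ℂ) (specialUnitaryUnits (Fin N)) x) (fun U => U) (𝔏 x).Gp (parH x) }

/-- ★★★ **THE SITE-(3.49) + `ν`-(3.132) OPERATOR LAYER WITH THE HÖLDER TRANSPORTER `parH` IN THE `G′` SLOT** (the shape the N06 certificate reads).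
[cite: Balaban1985BackgroundPropagators, Thm 3.1 (3.41)–(3.45) pp.397–398, (3.49) p.399, (3.132) p.422] -/
def opsYS349NuOfLettersH (N : ℕ) (θ : Stage3Params) (Mstar : ℕ) (𝔏 : LettersY N θ Mstar)
    (parH : ∀ x : MemberY θ.d₆ θ.ℓ₆ θ.hd' θ.hL' θ.b₀ θ.b₁ Mstar, SiteParY (Matrix (Fin N) (Fin N) ℂ) x.toKIdx) (𝔈 : ExpsY N θ Mstar) :
    OpsY N θ Mstar :=
  fun x => { opsYS349NuOfLetters N θ Mstar 𝔏 𝔈 x with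
    Gp := kernelFamilyS x.toKIdx (bg9Y (Matrix (Fin N) (Fin N) ℂ) (specialUnitaryUnits (Fin N)) x) (fun U => U) (𝔏 x).Gp (parH x) }

variable (N : ℕ) (θ : Stage3Params) (Mstar : ℕ) (𝔏 : LettersY N θ Mstar)
  (parH : ∀ x : MemberY θ.d₆ θ.ℓ₆ θ.hd' θ.hL' θ.b₀ θ.b₁ Mstar, SiteParY (Matrix (Fin N) (Fin N) ℂ) x.toKIdx) (𝔈 : ExpsY N θ Mstar)

/-- the `G′` slot: the letter `G′` read with Hölder transporter `parH x` (`rfl`). [cite: Balaban1985BackgroundPropagators, Thm 3.1 (3.41)–(3.45) pp.397–398] -/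
theorem opsYS349OfLettersH_Gp (x : MemberY θ.d₆ θ.ℓ₆ θ.hd' θ.hL' θ.b₀ θ.b₁ Mstar) :
    (opsYS349OfLettersH N θ Mstar 𝔏 parH 𝔈 x).Gp =
      kernelFamilyS x.toKIdx (bg9Y (Matrix (Fin N) (Fin N) ℂ) (specialUnitaryUnits (Fin N)) x) (fun U => U) (𝔏 x).Gp (parH x) := rfl

/-- the `G′` slot of the `ν`-read layer (`rfl`). [cite: Balaban1985BackgroundPropagators, Thm 3.1 (3.41)–(3.45) pp.397–398] -/
theorem opsYS349NuOfLettersH_Gp (x : MemberY θ.d₆ θ.ℓ₆ θ.hd' θ.hL' θ.b₀ θ.b₁ Mstar) :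
    (opsYS349NuOfLettersH N θ Mstar 𝔏 parH 𝔈 x).Gp =
      kernelFamilyS x.toKIdx (bg9Y (Matrix (Fin N) (Fin N) ℂ) (specialUnitaryUnits (Fin N)) x) (fun U => U) (𝔏 x).Gp (parH x) := rfl

/-- the (3.49) slot is UNCHANGED: `P = I − R(U)` over the letters' own (averaging) transporter `(𝔏 x).parS` (`rfl`).
[cite: Balaban1985BackgroundPropagators, (3.49) p.399 with (3.21) p.393] -/
theorem opsYS349NuOfLettersH_P349 (x : MemberY θ.d₆ θ.ℓ₆ θ.hd' θ.hL' θ.b₀ θ.b₁ Mstar) :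
    (opsYS349NuOfLettersH N θ Mstar 𝔏 parH 𝔈 x).P349 =
      fineKernelOfSiteOp x.toKIdx (bg9Y (Matrix (Fin N) (Fin N) ℂ) (specialUnitaryUnits (Fin N)) x) (fun U => U) (P349Y x.toKIdx (𝔏 x).parS (𝔏 x).Gp) := rfl

/-- the plain layer's (3.49) slot, likewise (`rfl`). [cite: Balaban1985BackgroundPropagators, (3.49) p.399 with (3.21) p.393] -/
theorem opsYS349OfLettersH_P349 (x : MemberY θ.d₆ θ.ℓ₆ θ.hd' θ.hL' θ.b₀ θ.b₁ Mstar) :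
    (opsYS349OfLettersH N θ Mstar 𝔏 parH 𝔈 x).P349 =
      fineKernelOfSiteOp x.toKIdx (bg9Y (Matrix (Fin N) (Fin N) ℂ) (specialUnitaryUnits (Fin N)) x) (fun U => U) (P349Y x.toKIdx (𝔏 x).parS (𝔏 x).Gp) := rfl

/-- off the `G′` slot, the operator letters of the `ν`-read layer ARE the site-(3.49) + `ν` layer's (`rfl` ×12).
[cite: Balaban1985BackgroundPropagators, Thms 3.2–3.14 pp.398–427, bookkeeping] -/
theorem opsYS349NuOfLettersH_offGp (x : MemberY θ.d₆ θ.ℓ₆ θ.hd' θ.hL' θ.b₀ θ.b₁ Mstar) :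
    (opsYS349NuOfLettersH N θ Mstar 𝔏 parH 𝔈 x).GA = (opsYS349NuOfLetters N θ Mstar 𝔏 𝔈 x).GA ∧
      (opsYS349NuOfLettersH N θ Mstar 𝔏 parH 𝔈 x).Cinv = (opsYS349NuOfLetters N θ Mstar 𝔏 𝔈 x).Cinv ∧
      (opsYS349NuOfLettersH N θ Mstar 𝔏 parH 𝔈 x).P349 = (opsYS349NuOfLetters N θ Mstar 𝔏 𝔈 x).P349 ∧
      (opsYS349NuOfLettersH N θ Mstar 𝔏 parH 𝔈 x).QGQinv = (opsYS349NuOfLetters N θ Mstar 𝔏 𝔈 x).QGQinv ∧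
      (opsYS349NuOfLettersH N θ Mstar 𝔏 parH 𝔈 x).QG1Qinv = (opsYS349NuOfLetters N θ Mstar 𝔏 𝔈 x).QG1Qinv ∧
      (opsYS349NuOfLettersH N θ Mstar 𝔏 parH 𝔈 x).GD = (opsYS349NuOfLetters N θ Mstar 𝔏 𝔈 x).GD ∧
      (opsYS349NuOfLettersH N θ Mstar 𝔏 parH 𝔈 x).G₁ = (opsYS349NuOfLetters N θ Mstar 𝔏 𝔈 x).G₁ ∧
      (opsYS349NuOfLettersH N θ Mstar 𝔏 parH 𝔈 x).H = (opsYS349NuOfLetters N θ Mstar 𝔏 𝔈 x).H ∧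
      (opsYS349NuOfLettersH N θ Mstar 𝔏 parH 𝔈 x).H₁ = (opsYS349NuOfLetters N θ Mstar 𝔏 𝔈 x).H₁ ∧
      (opsYS349NuOfLettersH N θ Mstar 𝔏 parH 𝔈 x).GG = (opsYS349NuOfLetters N θ Mstar 𝔏 𝔈 x).GG ∧
      (opsYS349NuOfLettersH N θ Mstar 𝔏 parH 𝔈 x).Kdiff = (opsYS349NuOfLetters N θ Mstar 𝔏 𝔈 x).Kdiff ∧
      (opsYS349NuOfLettersH N θ Mstar 𝔏 parH 𝔈 x).Ck = (opsYS349NuOfLetters N θ Mstar 𝔏 𝔈 x).Ck :=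
  ⟨rfl, rfl, rfl, rfl, rfl, rfl, rfl, rfl, rfl, rfl, rfl, rfl⟩

/-- off the `G′` slot, the exponent letters and predicates of the `ν`-read layer ARE the site-(3.49) + `ν` layer's (`rfl` ×10).
[cite: Balaban1985BackgroundPropagators, Thms 3.4–3.15 pp.400–432, bookkeeping] -/
theorem opsYS349NuOfLettersH_preds (x : MemberY θ.d₆ θ.ℓ₆ θ.hd' θ.hL' θ.b₀ θ.b₁ Mstar) :
    (opsYS349NuOfLettersH N θ Mstar 𝔏 parH 𝔈 x).IsAnalyticExt = (opsYS349NuOfLetters N θ Mstar 𝔏 𝔈 x).IsAnalyticExt ∧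
      (opsYS349NuOfLettersH N θ Mstar 𝔏 parH 𝔈 x).E37 = (opsYS349NuOfLetters N θ Mstar 𝔏 𝔈 x).E37 ∧
      (opsYS349NuOfLettersH N θ Mstar 𝔏 parH 𝔈 x).EK39 = (opsYS349NuOfLetters N θ Mstar 𝔏 𝔈 x).EK39 ∧
      (opsYS349NuOfLettersH N θ Mstar 𝔏 parH 𝔈 x).E310 = (opsYS349NuOfLetters N θ Mstar 𝔏 𝔈 x).E310 ∧
      (opsYS349NuOfLettersH N θ Mstar 𝔏 parH 𝔈 x).PosDef = (opsYS349NuOfLetters N θ Mstar 𝔏 𝔈 x).PosDef ∧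
      (opsYS349NuOfLettersH N θ Mstar 𝔏 parH 𝔈 x).HasRWExp = (opsYS349NuOfLetters N θ Mstar 𝔏 𝔈 x).HasRWExp ∧
      (opsYS349NuOfLettersH N θ Mstar 𝔏 parH 𝔈 x).HasRWExpH = (opsYS349NuOfLetters N θ Mstar 𝔏 𝔈 x).HasRWExpH ∧
      (opsYS349NuOfLettersH N θ Mstar 𝔏 parH 𝔈 x).PosDefK = (opsYS349NuOfLetters N θ Mstar 𝔏 𝔈 x).PosDefK ∧
      (opsYS349NuOfLettersH N θ Mstar 𝔏 parH 𝔈 x).GivenBy3185 = (opsYS349NuOfLetters N θ Mstar 𝔏 𝔈 x).GivenBy3185 ∧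
      (opsYS349NuOfLettersH N θ Mstar 𝔏 parH 𝔈 x).HasRWExpC = (opsYS349NuOfLetters N θ Mstar 𝔏 𝔈 x).HasRWExpC :=
  ⟨rfl, rfl, rfl, rfl, rfl, rfl, rfl, rfl, rfl, rfl⟩

/-- off the `G′` slot, the plain layer's operator letters ARE the site-(3.49) layer's (`rfl` ×12). [cite: Balaban1985BackgroundPropagators, Thms 3.2–3.14 pp.398–427, bookkeeping] -/
theorem opsYS349OfLettersH_offGp (x : MemberY θ.d₆ θ.ℓ₆ θ.hd' θ.hL' θ.b₀ θ.b₁ Mstar) :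
    (opsYS349OfLettersH N θ Mstar 𝔏 parH 𝔈 x).GA = (opsYS349OfLetters N θ Mstar 𝔏 𝔈 x).GA ∧
      (opsYS349OfLettersH N θ Mstar 𝔏 parH 𝔈 x).Cinv = (opsYS349OfLetters N θ Mstar 𝔏 𝔈 x).Cinv ∧
      (opsYS349OfLettersH N θ Mstar 𝔏 parH 𝔈 x).P349 = (opsYS349OfLetters N θ Mstar 𝔏 𝔈 x).P349 ∧
      (opsYS349OfLettersH N θ Mstar 𝔏 parH 𝔈 x).QGQinv = (opsYS349OfLetters N θ Mstar 𝔏 𝔈 x).QGQinv ∧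
      (opsYS349OfLettersH N θ Mstar 𝔏 parH 𝔈 x).QG1Qinv = (opsYS349OfLetters N θ Mstar 𝔏 𝔈 x).QG1Qinv ∧
      (opsYS349OfLettersH N θ Mstar 𝔏 parH 𝔈 x).GD = (opsYS349OfLetters N θ Mstar 𝔏 𝔈 x).GD ∧
      (opsYS349OfLettersH N θ Mstar 𝔏 parH 𝔈 x).G₁ = (opsYS349OfLetters N θ Mstar 𝔏 𝔈 x).G₁ ∧
      (opsYS349OfLettersH N θ Mstar 𝔏 parH 𝔈 x).H = (opsYS349OfLetters N θ Mstar 𝔏 𝔈 x).H ∧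
      (opsYS349OfLettersH N θ Mstar 𝔏 parH 𝔈 x).H₁ = (opsYS349OfLetters N θ Mstar 𝔏 𝔈 x).H₁ ∧
      (opsYS349OfLettersH N θ Mstar 𝔏 parH 𝔈 x).GG = (opsYS349OfLetters N θ Mstar 𝔏 𝔈 x).GG ∧
      (opsYS349OfLettersH N θ Mstar 𝔏 parH 𝔈 x).Kdiff = (opsYS349OfLetters N θ Mstar 𝔏 𝔈 x).Kdiff ∧
      (opsYS349OfLettersH N θ Mstar 𝔏 parH 𝔈 x).Ck = (opsYS349OfLetters N θ Mstar 𝔏 𝔈 x).Ck :=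
  ⟨rfl, rfl, rfl, rfl, rfl, rfl, rfl, rfl, rfl, rfl, rfl, rfl⟩

/-- ★ THE DIAGONAL INSTANCE: injecting the letters' own transporter `parH := fun x => (𝔏 x).parS` gives back the site-(3.49) + `ν` layer (`rfl`).
[cite: Balaban1985BackgroundPropagators, (3.40) p.397, bookkeeping] -/
theorem opsYS349NuOfLettersH_parS : opsYS349NuOfLettersH N θ Mstar 𝔏 (fun x => (𝔏 x).parS) 𝔈 = opsYS349NuOfLetters N θ Mstar 𝔏 𝔈 := rfl

/-- ★ the diagonal instance of the plain layer (`rfl`). [cite: Balaban1985BackgroundPropagators, (3.40) p.397, bookkeeping] -/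
theorem opsYS349OfLettersH_parS : opsYS349OfLettersH N θ Mstar 𝔏 (fun x => (𝔏 x).parS) 𝔈 = opsYS349OfLetters N θ Mstar 𝔏 𝔈 := rfl

end Constructors

/-! ## §2 The v11 records with the Hölder slot, PARAMETRIC ONCE in `parH`; the knit instances of record at `parH := parSymY` -/

section Record

open scoped Matrix.Norms.L2Operator

/-- ★★★ **THE PLAIN v11 STAR RECORD WITH HÖLDER SLOT `parH`**: `opsYSectESt … (opsYS349OfLettersH … 𝔏 parH 𝔈) 𝔏 𝔢 𝔴` at the v11 letters of record
`𝔏 := lettersYOfRecordV11 … 𝔮 𝔮⋆ h𝔮 h𝔮⋆ 𝔯` (`parS := parKnitY`, read by `P349`, Thm 3.9, Thm 3.11 as the AVERAGING transporter).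
[cite: Balaban1985BackgroundPropagators, Thms 3.1–3.15 pp.397–432, (3.40) p.397, (3.115) p.418] -/
def opsYStOfRecordV11ESH (N : ℕ) (θ : Stage3Params) (Mstar : ℕ) (𝔮 : QFamY N θ) (𝔮s : QsFamY N θ)
    (h𝔮 : ∀ i, 𝔮 i (fun _ _ => 1) = liftMatY (Matrix (Fin N) (Fin N) ℂ) (qK i))
    (h𝔮s : ∀ i, 𝔮s i (fun _ _ => 1) = liftMatY (Matrix (Fin N) (Fin N) ℂ) (qsK i)) (𝔯 : ResY N θ Mstar)
    (parH : ∀ x : MemberY θ.d₆ θ.ℓ₆ θ.hd' θ.hL' θ.b₀ θ.b₁ Mstar, SiteParY (Matrix (Fin N) (Fin N) ℂ) x.toKIdx) (𝔢 : SectEStY N θ Mstar)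
    (𝔴 : RWEY N θ Mstar) (𝔈 : ExpsY N θ Mstar) : OpsY N θ Mstar :=
  opsYSectESt N θ Mstar (opsYS349OfLettersH N θ Mstar (lettersYOfRecordV11 N θ Mstar 𝔮 𝔮s h𝔮 h𝔮s 𝔯) parH 𝔈)
    (lettersYOfRecordV11 N θ Mstar 𝔮 𝔮s h𝔮 h𝔮s 𝔯) 𝔢 𝔴

/-- ★★★ **THE `ν`-READ v11 STAR RECORD WITH HÖLDER SLOT `parH`** (the shape the N06 certificate reads).
[cite: Balaban1985BackgroundPropagators, Thms 3.1–3.15 pp.397–432, (3.40) p.397, (3.115) p.418, (3.132) p.422] -/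
def opsYNuStOfRecordV11ESH (N : ℕ) (θ : Stage3Params) (Mstar : ℕ) (𝔮 : QFamY N θ) (𝔮s : QsFamY N θ)
    (h𝔮 : ∀ i, 𝔮 i (fun _ _ => 1) = liftMatY (Matrix (Fin N) (Fin N) ℂ) (qK i))
    (h𝔮s : ∀ i, 𝔮s i (fun _ _ => 1) = liftMatY (Matrix (Fin N) (Fin N) ℂ) (qsK i)) (𝔯 : ResY N θ Mstar)
    (parH : ∀ x : MemberY θ.d₆ θ.ℓ₆ θ.hd' θ.hL' θ.b₀ θ.b₁ Mstar, SiteParY (Matrix (Fin N) (Fin N) ℂ) x.toKIdx) (𝔢 : SectEStY N θ Mstar)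
    (𝔴 : RWEY N θ Mstar) (𝔈 : ExpsY N θ Mstar) : OpsY N θ Mstar :=
  opsYSectESt N θ Mstar (opsYS349NuOfLettersH N θ Mstar (lettersYOfRecordV11 N θ Mstar 𝔮 𝔮s h𝔮 h𝔮s 𝔯) parH 𝔈)
    (lettersYOfRecordV11 N θ Mstar 𝔮 𝔮s h𝔮 h𝔮s 𝔯) 𝔢 𝔴

variable (N : ℕ) (θ : Stage3Params) (Mstar : ℕ) (𝔮 : QFamY N θ) (𝔮s : QsFamY N θ)
  (h𝔮 : ∀ i, 𝔮 i (fun _ _ => 1) = liftMatY (Matrix (Fin N) (Fin N) ℂ) (qK i))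
  (h𝔮s : ∀ i, 𝔮s i (fun _ _ => 1) = liftMatY (Matrix (Fin N) (Fin N) ℂ) (qsK i)) (𝔯 : ResY N θ Mstar)
  (parH : ∀ x : MemberY θ.d₆ θ.ℓ₆ θ.hd' θ.hL' θ.b₀ θ.b₁ Mstar, SiteParY (Matrix (Fin N) (Fin N) ℂ) x.toKIdx)
  (𝔢 : SectEStY N θ Mstar) (𝔴 : RWEY N θ Mstar) (𝔈 : ExpsY N θ Mstar)
  (R₁ R₂ : RegFamY θ.d₆ θ.ℓ₆ θ.hd' θ.hL' θ.b₀ θ.b₁ Mstar (Matrix (Fin N) (Fin N) ℂ))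

/-- at the diagonal `parH := parKnitY` the `ν`-read record IS the v11 instance of record `opsYNuStOfRecordV11E` (`rfl`).
[cite: Balaban1985BackgroundPropagators, (3.40) p.397, (3.115) p.418, bookkeeping] -/
theorem opsYNuStOfRecordV11ESH_parKnitY :
    opsYNuStOfRecordV11ESH N θ Mstar 𝔮 𝔮s h𝔮 h𝔮s 𝔯 (fun x => parKnitY x.toKIdx) 𝔢 𝔴 𝔈 =
      opsYNuStOfRecordV11E N θ Mstar 𝔮 𝔮s h𝔮 h𝔮s 𝔯 𝔢 𝔴 𝔈 := rfl

/-- at the diagonal `parH := parKnitY` the plain record IS `opsYStOfRecordV11E` (`rfl`). [cite: Balaban1985BackgroundPropagators, (3.40) p.397, bookkeeping] -/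
theorem opsYStOfRecordV11ESH_parKnitY :
    opsYStOfRecordV11ESH N θ Mstar 𝔮 𝔮s h𝔮 h𝔮s 𝔯 (fun x => parKnitY x.toKIdx) 𝔢 𝔴 𝔈 =
      opsYStOfRecordV11E N θ Mstar 𝔮 𝔮s h𝔮 h𝔮s 𝔯 𝔢 𝔴 𝔈 := rfl

/-- the `ν`-read record at a member, unfolded: the star Sect.-E layer over the Hölder-slot site-(3.49) + `ν` layer (`rfl`).
[cite: Balaban1985BackgroundPropagators, Thm 3.15 p.432, (3.132) p.422, bookkeeping] -/
theorem opsYNuStOfRecordV11ESH_apply (x : MemberY θ.d₆ θ.ℓ₆ θ.hd' θ.hL' θ.b₀ θ.b₁ Mstar) :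
    opsYNuStOfRecordV11ESH N θ Mstar 𝔮 𝔮s h𝔮 h𝔮s 𝔯 parH 𝔢 𝔴 𝔈 x =
      operatorLayerYSectESt (Matrix (Fin N) (Fin N) ℂ) (specialUnitaryUnits (Fin N)) x
        (opsYS349NuOfLettersH N θ Mstar (lettersYOfRecordV11 N θ Mstar 𝔮 𝔮s h𝔮 h𝔮s 𝔯) parH 𝔈 x)
        (lettersYOfRecordV11 N θ Mstar 𝔮 𝔮s h𝔮 h𝔮s 𝔯 x) (𝔢 x) (𝔴 x) := rfl

/-- the plain record at a member, unfolded (`rfl`). [cite: Balaban1985BackgroundPropagators, Thm 3.15 p.432, bookkeeping] -/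
theorem opsYStOfRecordV11ESH_apply (x : MemberY θ.d₆ θ.ℓ₆ θ.hd' θ.hL' θ.b₀ θ.b₁ Mstar) :
    opsYStOfRecordV11ESH N θ Mstar 𝔮 𝔮s h𝔮 h𝔮s 𝔯 parH 𝔢 𝔴 𝔈 x =
      operatorLayerYSectESt (Matrix (Fin N) (Fin N) ℂ) (specialUnitaryUnits (Fin N)) x
        (opsYS349OfLettersH N θ Mstar (lettersYOfRecordV11 N θ Mstar 𝔮 𝔮s h𝔮 h𝔮s 𝔯) parH 𝔈 x)
        (lettersYOfRecordV11 N θ Mstar 𝔮 𝔮s h𝔮 h𝔮s 𝔯 x) (𝔢 x) (𝔴 x) := rfl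

/-- ★★★ PIN `hGpPin` (generic Hölder slot): the re-based `G′` family IS `kernelFamilyS … (G′(parKnitY x)) (parH x)`.
[cite: Balaban1985BackgroundPropagators, Thm 3.1 (3.41)–(3.45) pp.397–398] -/
theorem opsYNuStOfRecordV11ESH_GpPin (x : MemberY θ.d₆ θ.ℓ₆ θ.hd' θ.hL' θ.b₀ θ.b₁ Mstar) :
    kernelFamilyR R₁ R₂ (opsYNuStOfRecordV11ESH N θ Mstar 𝔮 𝔮s h𝔮 h𝔮s 𝔯 parH 𝔢 𝔴 𝔈 x).Gp =
      kernelFamilyS x.toKIdx (bg9YR (Matrix (Fin N) (Fin N) ℂ) (specialUnitaryUnits (Fin N)) R₁ R₂ x) (fun U => U)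
        (GpY x.toKIdx (parKnitY x.toKIdx)) (parH x) := rfl

/-- ★★★ PIN `hGAPin` (unchanged from v11): `G[𝔮 x](parKnitY, G′_latt)` with bond transporter `parBY`. [cite: Balaban1985BackgroundPropagators, Thm 3.3 p.399, (3.27) p.395] -/
theorem opsYNuStOfRecordV11ESH_GAPin (x : MemberY θ.d₆ θ.ℓ₆ θ.hd' θ.hL' θ.b₀ θ.b₁ Mstar) :
    kernelFamilyR R₁ R₂ (opsYNuStOfRecordV11ESH N θ Mstar 𝔮 𝔮s h𝔮 h𝔮s 𝔯 parH 𝔢 𝔴 𝔈 x).GA =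
      kernelFamilyB x.toKIdx (bg9YR (Matrix (Fin N) (Fin N) ℂ) (specialUnitaryUnits (Fin N)) R₁ R₂ x) (fun U => U)
        (GAQY x.toKIdx (𝔮 x.toKIdx) (𝔮s x.toKIdx) (parKnitY x.toKIdx) (GpY x.toKIdx (parKnitY x.toKIdx))) (parBY x.toKIdx) := rfl

/-- ★ the same pin with `G[𝔮 x]` fed `G′_phys`. [cite: Balaban1985BackgroundPropagators, Thm 3.3 p.399, (3.25)–(3.27) pp.394–395] -/
theorem opsYNuStOfRecordV11ESH_GAPin_phys (x : MemberY θ.d₆ θ.ℓ₆ θ.hd' θ.hL' θ.b₀ θ.b₁ Mstar) :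
    kernelFamilyR R₁ R₂ (opsYNuStOfRecordV11ESH N θ Mstar 𝔮 𝔮s h𝔮 h𝔮s 𝔯 parH 𝔢 𝔴 𝔈 x).GA =
      kernelFamilyB x.toKIdx (bg9YR (Matrix (Fin N) (Fin N) ℂ) (specialUnitaryUnits (Fin N)) R₁ R₂ x) (fun U => U)
        (GAQY x.toKIdx (𝔮 x.toKIdx) (𝔮s x.toKIdx) (parKnitY x.toKIdx) (GpPhysY x.toKIdx (parKnitY x.toKIdx))) (parBY x.toKIdx) := by
  rw [GAQY_GpPhysY]; rfl

/-- ★★★ PIN `hCinvPin` (unchanged from v11): the re-based `Cinv` IS the block kernel of `C(U; parKnitY, G′(parKnitY))`. [cite: Balaban1985BackgroundPropagators, Thm 3.2 (3.48) p.398] -/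
theorem opsYNuStOfRecordV11ESH_CinvPin (x : MemberY θ.d₆ θ.ℓ₆ θ.hd' θ.hL' θ.b₀ θ.b₁ Mstar) :
    siteKernelR R₁ R₂ (opsYNuStOfRecordV11ESH N θ Mstar 𝔮 𝔮s h𝔮 h𝔮s 𝔯 parH 𝔢 𝔴 𝔈 x).Cinv =
      siteKernelOfOp x.toKIdx (bg9YR (Matrix (Fin N) (Fin N) ℂ) (specialUnitaryUnits (Fin N)) R₁ R₂ x) (fun U => U)
        (CY x.toKIdx (parKnitY x.toKIdx) (GpY x.toKIdx (parKnitY x.toKIdx))) (β x.hN x.D x.hk) (β x.hN x.D x.hk) := rfl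

/-- ★★★ THE (3.49) SLOT (ref-E ⚑ K0-H-P349 answered): `P = I − R(U)` with the AVERAGING transporter `parKnitY x` inside `R(U)` and `G′ = G′(parKnitY x)` (`rfl`).
[cite: Balaban1985BackgroundPropagators, (3.49) p.399 with (3.21) p.393, (3.115) p.418] -/
theorem opsYNuStOfRecordV11ESH_P349 (x : MemberY θ.d₆ θ.ℓ₆ θ.hd' θ.hL' θ.b₀ θ.b₁ Mstar) :
    (opsYNuStOfRecordV11ESH N θ Mstar 𝔮 𝔮s h𝔮 h𝔮s 𝔯 parH 𝔢 𝔴 𝔈 x).P349 =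
      fineKernelOfSiteOp x.toKIdx (bg9Y (Matrix (Fin N) (Fin N) ℂ) (specialUnitaryUnits (Fin N)) x) (fun U => U)
        (P349Y x.toKIdx (parKnitY x.toKIdx) (GpY x.toKIdx (parKnitY x.toKIdx))) := rfl

/-- off the `G′` slot the `ν`-read record IS the v11 instance of record, operator letters (by the star layer's faces and unfolding §1).
[cite: Balaban1985BackgroundPropagators, Thms 3.2–3.14 pp.398–427, bookkeeping] -/
theorem opsYNuStOfRecordV11ESH_offGp (x : MemberY θ.d₆ θ.ℓ₆ θ.hd' θ.hL' θ.b₀ θ.b₁ Mstar) :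
    (opsYNuStOfRecordV11ESH N θ Mstar 𝔮 𝔮s h𝔮 h𝔮s 𝔯 parH 𝔢 𝔴 𝔈 x).GA = (opsYNuStOfRecordV11E N θ Mstar 𝔮 𝔮s h𝔮 h𝔮s 𝔯 𝔢 𝔴 𝔈 x).GA ∧
      (opsYNuStOfRecordV11ESH N θ Mstar 𝔮 𝔮s h𝔮 h𝔮s 𝔯 parH 𝔢 𝔴 𝔈 x).Cinv = (opsYNuStOfRecordV11E N θ Mstar 𝔮 𝔮s h𝔮 h𝔮s 𝔯 𝔢 𝔴 𝔈 x).Cinv ∧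
      (opsYNuStOfRecordV11ESH N θ Mstar 𝔮 𝔮s h𝔮 h𝔮s 𝔯 parH 𝔢 𝔴 𝔈 x).P349 = (opsYNuStOfRecordV11E N θ Mstar 𝔮 𝔮s h𝔮 h𝔮s 𝔯 𝔢 𝔴 𝔈 x).P349 ∧
      (opsYNuStOfRecordV11ESH N θ Mstar 𝔮 𝔮s h𝔮 h𝔮s 𝔯 parH 𝔢 𝔴 𝔈 x).QGQinv = (opsYNuStOfRecordV11E N θ Mstar 𝔮 𝔮s h𝔮 h𝔮s 𝔯 𝔢 𝔴 𝔈 x).QGQinv ∧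
      (opsYNuStOfRecordV11ESH N θ Mstar 𝔮 𝔮s h𝔮 h𝔮s 𝔯 parH 𝔢 𝔴 𝔈 x).QG1Qinv = (opsYNuStOfRecordV11E N θ Mstar 𝔮 𝔮s h𝔮 h𝔮s 𝔯 𝔢 𝔴 𝔈 x).QG1Qinv ∧
      (opsYNuStOfRecordV11ESH N θ Mstar 𝔮 𝔮s h𝔮 h𝔮s 𝔯 parH 𝔢 𝔴 𝔈 x).GD = (opsYNuStOfRecordV11E N θ Mstar 𝔮 𝔮s h𝔮 h𝔮s 𝔯 𝔢 𝔴 𝔈 x).GD ∧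
      (opsYNuStOfRecordV11ESH N θ Mstar 𝔮 𝔮s h𝔮 h𝔮s 𝔯 parH 𝔢 𝔴 𝔈 x).G₁ = (opsYNuStOfRecordV11E N θ Mstar 𝔮 𝔮s h𝔮 h𝔮s 𝔯 𝔢 𝔴 𝔈 x).G₁ ∧
      (opsYNuStOfRecordV11ESH N θ Mstar 𝔮 𝔮s h𝔮 h𝔮s 𝔯 parH 𝔢 𝔴 𝔈 x).H = (opsYNuStOfRecordV11E N θ Mstar 𝔮 𝔮s h𝔮 h𝔮s 𝔯 𝔢 𝔴 𝔈 x).H ∧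
      (opsYNuStOfRecordV11ESH N θ Mstar 𝔮 𝔮s h𝔮 h𝔮s 𝔯 parH 𝔢 𝔴 𝔈 x).H₁ = (opsYNuStOfRecordV11E N θ Mstar 𝔮 𝔮s h𝔮 h𝔮s 𝔯 𝔢 𝔴 𝔈 x).H₁ ∧
      (opsYNuStOfRecordV11ESH N θ Mstar 𝔮 𝔮s h𝔮 h𝔮s 𝔯 parH 𝔢 𝔴 𝔈 x).GG = (opsYNuStOfRecordV11E N θ Mstar 𝔮 𝔮s h𝔮 h𝔮s 𝔯 𝔢 𝔴 𝔈 x).GG ∧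
      (opsYNuStOfRecordV11ESH N θ Mstar 𝔮 𝔮s h𝔮 h𝔮s 𝔯 parH 𝔢 𝔴 𝔈 x).Kdiff = (opsYNuStOfRecordV11E N θ Mstar 𝔮 𝔮s h𝔮 h𝔮s 𝔯 𝔢 𝔴 𝔈 x).Kdiff ∧
      (opsYNuStOfRecordV11ESH N θ Mstar 𝔮 𝔮s h𝔮 h𝔮s 𝔯 parH 𝔢 𝔴 𝔈 x).Ck = (opsYNuStOfRecordV11E N θ Mstar 𝔮 𝔮s h𝔮 h𝔮s 𝔯 𝔢 𝔴 𝔈 x).Ck := by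
  simp only [opsYNuStOfRecordV11ESH_apply, opsYNuStOfRecordV11E_apply, operatorLayerYSectESt_GA, operatorLayerYSectESt_Cinv,
    operatorLayerYSectESt_P349, operatorLayerYSectESt_QGQinv, operatorLayerYSectESt_QG1Qinv, operatorLayerYSectESt_GD,
    operatorLayerYSectESt_G₁, operatorLayerYSectESt_H, operatorLayerYSectESt_H₁, operatorLayerYSectESt_GG, operatorLayerYSectESt_Kdiff,
    operatorLayerYSectESt_Ck, opsYS349NuOfLettersH, and_self]

/-- off the `G′` slot the `ν`-read record IS the v11 instance of record, exponent letters and predicates (same proof).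
[cite: Balaban1985BackgroundPropagators, Thms 3.4–3.15 pp.400–432, bookkeeping] -/
theorem opsYNuStOfRecordV11ESH_preds (x : MemberY θ.d₆ θ.ℓ₆ θ.hd' θ.hL' θ.b₀ θ.b₁ Mstar) :
    (opsYNuStOfRecordV11ESH N θ Mstar 𝔮 𝔮s h𝔮 h𝔮s 𝔯 parH 𝔢 𝔴 𝔈 x).IsAnalyticExt =
        (opsYNuStOfRecordV11E N θ Mstar 𝔮 𝔮s h𝔮 h𝔮s 𝔯 𝔢 𝔴 𝔈 x).IsAnalyticExt ∧
      (opsYNuStOfRecordV11ESH N θ Mstar 𝔮 𝔮s h𝔮 h𝔮s 𝔯 parH 𝔢 𝔴 𝔈 x).E37 = (opsYNuStOfRecordV11E N θ Mstar 𝔮 𝔮s h𝔮 h𝔮s 𝔯 𝔢 𝔴 𝔈 x).E37 ∧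
      (opsYNuStOfRecordV11ESH N θ Mstar 𝔮 𝔮s h𝔮 h𝔮s 𝔯 parH 𝔢 𝔴 𝔈 x).EK39 = (opsYNuStOfRecordV11E N θ Mstar 𝔮 𝔮s h𝔮 h𝔮s 𝔯 𝔢 𝔴 𝔈 x).EK39 ∧
      (opsYNuStOfRecordV11ESH N θ Mstar 𝔮 𝔮s h𝔮 h𝔮s 𝔯 parH 𝔢 𝔴 𝔈 x).E310 = (opsYNuStOfRecordV11E N θ Mstar 𝔮 𝔮s h𝔮 h𝔮s 𝔯 𝔢 𝔴 𝔈 x).E310 ∧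
      (opsYNuStOfRecordV11ESH N θ Mstar 𝔮 𝔮s h𝔮 h𝔮s 𝔯 parH 𝔢 𝔴 𝔈 x).PosDef = (opsYNuStOfRecordV11E N θ Mstar 𝔮 𝔮s h𝔮 h𝔮s 𝔯 𝔢 𝔴 𝔈 x).PosDef ∧
      (opsYNuStOfRecordV11ESH N θ Mstar 𝔮 𝔮s h𝔮 h𝔮s 𝔯 parH 𝔢 𝔴 𝔈 x).HasRWExp =
        (opsYNuStOfRecordV11E N θ Mstar 𝔮 𝔮s h𝔮 h𝔮s 𝔯 𝔢 𝔴 𝔈 x).HasRWExp ∧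
      (opsYNuStOfRecordV11ESH N θ Mstar 𝔮 𝔮s h𝔮 h𝔮s 𝔯 parH 𝔢 𝔴 𝔈 x).HasRWExpH =
        (opsYNuStOfRecordV11E N θ Mstar 𝔮 𝔮s h𝔮 h𝔮s 𝔯 𝔢 𝔴 𝔈 x).HasRWExpH ∧
      (opsYNuStOfRecordV11ESH N θ Mstar 𝔮 𝔮s h𝔮 h𝔮s 𝔯 parH 𝔢 𝔴 𝔈 x).PosDefK = (opsYNuStOfRecordV11E N θ Mstar 𝔮 𝔮s h𝔮 h𝔮s 𝔯 𝔢 𝔴 𝔈 x).PosDefK ∧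
      (opsYNuStOfRecordV11ESH N θ Mstar 𝔮 𝔮s h𝔮 h𝔮s 𝔯 parH 𝔢 𝔴 𝔈 x).GivenBy3185 =
        (opsYNuStOfRecordV11E N θ Mstar 𝔮 𝔮s h𝔮 h𝔮s 𝔯 𝔢 𝔴 𝔈 x).GivenBy3185 ∧
      (opsYNuStOfRecordV11ESH N θ Mstar 𝔮 𝔮s h𝔮 h𝔮s 𝔯 parH 𝔢 𝔴 𝔈 x).HasRWExpC =
        (opsYNuStOfRecordV11E N θ Mstar 𝔮 𝔮s h𝔮 h𝔮s 𝔯 𝔢 𝔴 𝔈 x).HasRWExpC := by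
  simp only [opsYNuStOfRecordV11ESH_apply, opsYNuStOfRecordV11E_apply, operatorLayerYSectESt_IsAnalyticExt, operatorLayerYSectESt_E37,
    operatorLayerYSectESt_EK39, operatorLayerYSectESt_E310, operatorLayerYSectESt_PosDef, operatorLayerYSectESt_HasRWExp,
    operatorLayerYSectESt_HasRWExpH, operatorLayerYSectESt_PosDefK, operatorLayerYSectESt_GivenBy3185, operatorLayerYSectESt_HasRWExpC,
    opsYS349NuOfLettersH, and_self]

/-- ★ the plain record's three leaf pins and (3.49) slot (same right-hand sides). [cite: Balaban1985BackgroundPropagators, Thms 3.1–3.3 pp.397–400, (3.49) p.399] -/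
theorem opsYStOfRecordV11ESH_pins (x : MemberY θ.d₆ θ.ℓ₆ θ.hd' θ.hL' θ.b₀ θ.b₁ Mstar) :
    kernelFamilyR R₁ R₂ (opsYStOfRecordV11ESH N θ Mstar 𝔮 𝔮s h𝔮 h𝔮s 𝔯 parH 𝔢 𝔴 𝔈 x).Gp =
        kernelFamilyS x.toKIdx (bg9YR (Matrix (Fin N) (Fin N) ℂ) (specialUnitaryUnits (Fin N)) R₁ R₂ x) (fun U => U)
          (GpY x.toKIdx (parKnitY x.toKIdx)) (parH x) ∧
      kernelFamilyR R₁ R₂ (opsYStOfRecordV11ESH N θ Mstar 𝔮 𝔮s h𝔮 h𝔮s 𝔯 parH 𝔢 𝔴 𝔈 x).GA =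
        kernelFamilyB x.toKIdx (bg9YR (Matrix (Fin N) (Fin N) ℂ) (specialUnitaryUnits (Fin N)) R₁ R₂ x) (fun U => U)
          (GAQY x.toKIdx (𝔮 x.toKIdx) (𝔮s x.toKIdx) (parKnitY x.toKIdx) (GpY x.toKIdx (parKnitY x.toKIdx))) (parBY x.toKIdx) ∧
      siteKernelR R₁ R₂ (opsYStOfRecordV11ESH N θ Mstar 𝔮 𝔮s h𝔮 h𝔮s 𝔯 parH 𝔢 𝔴 𝔈 x).Cinv =
        siteKernelOfOp x.toKIdx (bg9YR (Matrix (Fin N) (Fin N) ℂ) (specialUnitaryUnits (Fin N)) R₁ R₂ x) (fun U => U)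
          (CY x.toKIdx (parKnitY x.toKIdx) (GpY x.toKIdx (parKnitY x.toKIdx))) (β x.hN x.D x.hk) (β x.hN x.D x.hk) ∧
      (opsYStOfRecordV11ESH N θ Mstar 𝔮 𝔮s h𝔮 h𝔮s 𝔯 parH 𝔢 𝔴 𝔈 x).P349 =
        fineKernelOfSiteOp x.toKIdx (bg9Y (Matrix (Fin N) (Fin N) ℂ) (specialUnitaryUnits (Fin N)) x) (fun U => U)
          (P349Y x.toKIdx (parKnitY x.toKIdx) (GpY x.toKIdx (parKnitY x.toKIdx))) := ⟨rfl, rfl, rfl, rfl⟩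

/-- ☆ FOR THE RECORD (ref-E ⚑ K0-H-P349): edition 2's letter reset moves the (3.49) slot too — `opsYNuStOfRecordV11HE`'s `P349` reads the SHORTEST-contour
transporter `parSymY` inside `R(U)` (`rfl`); the present edition does not. [cite: Balaban1985BackgroundPropagators, (3.49) p.399 with (3.21) p.393, (3.40) p.397] -/
theorem opsYNuStOfRecordV11HE_P349 (x : MemberY θ.d₆ θ.ℓ₆ θ.hd' θ.hL' θ.b₀ θ.b₁ Mstar) :
    (opsYNuStOfRecordV11HE N θ Mstar 𝔮 𝔮s h𝔮 h𝔮s 𝔯 𝔢 𝔴 𝔈 x).P349 =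
      fineKernelOfSiteOp x.toKIdx (bg9Y (Matrix (Fin N) (Fin N) ℂ) (specialUnitaryUnits (Fin N)) x) (fun U => U)
        (P349Y x.toKIdx (parSymY x.toKIdx) (GpY x.toKIdx (parKnitY x.toKIdx))) := rfl

end Record

/-! ## §3 ★★★ The knit instances of record: knit pair, `parS := parKnitY` (averaging), Hölder slot `parH := parSymY` -/

section RecordKnit

open scoped Matrix.Norms.L2Operator

/-- ★★★ **THE PLAIN KNIT INSTANCE WITH BOTH TRANSPORTER ROLES AT PRINT'S VALUES**: v11 knit letters (`parKnitY` in every averaging role) and Hölder slot `parSymY`.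
[cite: Balaban1985BackgroundPropagators, Thms 3.1–3.15 pp.397–432, (3.40) p.397, (3.115) p.418] [cite: Balaban1985Averaging, (15) p.19, Prop. 2 p.26] -/
def opsYStOfRecordV11KSE (N : ℕ) [Nonempty (Fin N)] (θ : Stage3Params) (Mstar : ℕ) (𝔯 : ResY N θ Mstar) (𝔢 : SectEStY N θ Mstar)
    (𝔴 : RWEY N θ Mstar) (𝔈 : ExpsY N θ Mstar) : OpsY N θ Mstar :=
  opsYStOfRecordV11ESH N θ Mstar (qKnitOfRecord N θ) (qsKnitOfRecord N θ) (qKnitOfRecord_flat N θ) (qsKnitOfRecord_flat N θ) 𝔯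
    (fun x => parSymY x.toKIdx) 𝔢 𝔴 𝔈

/-- ★★★ **THE `ν`-READ KNIT INSTANCE WITH BOTH TRANSPORTER ROLES AT PRINT'S VALUES** — the candidate object of a K3 knit certificate: `G′` slot
`kernelFamilyS … (G′(parKnitY)) parSymY`, (3.49) slot over `parKnitY`, every other slot the v11 knit instance's.
[cite: Balaban1985BackgroundPropagators, Thms 3.1–3.15 pp.397–432, (3.40) p.397, (3.115) p.418, (3.132) p.422] [cite: Balaban1985Averaging, (15) p.19, Prop. 2 p.26] -/
def opsYNuStOfRecordV11KSE (N : ℕ) [Nonempty (Fin N)] (θ : Stage3Params) (Mstar : ℕ) (𝔯 : ResY N θ Mstar) (𝔢 : SectEStY N θ Mstar)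
    (𝔴 : RWEY N θ Mstar) (𝔈 : ExpsY N θ Mstar) : OpsY N θ Mstar :=
  opsYNuStOfRecordV11ESH N θ Mstar (qKnitOfRecord N θ) (qsKnitOfRecord N θ) (qKnitOfRecord_flat N θ) (qsKnitOfRecord_flat N θ) 𝔯
    (fun x => parSymY x.toKIdx) 𝔢 𝔴 𝔈

variable (N : ℕ) [Nonempty (Fin N)] (θ : Stage3Params) (Mstar : ℕ) (𝔯 : ResY N θ Mstar) (𝔢 : SectEStY N θ Mstar) (𝔴 : RWEY N θ Mstar)
  (𝔈 : ExpsY N θ Mstar) (R₁ R₂ : RegFamY θ.d₆ θ.ℓ₆ θ.hd' θ.hL' θ.b₀ θ.b₁ Mstar (Matrix (Fin N) (Fin N) ℂ))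

/-- the plain knit instance IS the parametric record at the knit pair and `parH := parSymY` (`rfl`). [cite: Balaban1985BackgroundPropagators, (3.40) p.397, (3.115) p.418, bookkeeping] -/
theorem opsYStOfRecordV11KSE_eq : opsYStOfRecordV11KSE N θ Mstar 𝔯 𝔢 𝔴 𝔈 =
    opsYStOfRecordV11ESH N θ Mstar (qKnitOfRecord N θ) (qsKnitOfRecord N θ) (qKnitOfRecord_flat N θ) (qsKnitOfRecord_flat N θ) 𝔯
      (fun x => parSymY x.toKIdx) 𝔢 𝔴 𝔈 := rfl

/-- the `ν`-read knit instance IS the parametric record at the knit pair and `parH := parSymY` (`rfl`).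
[cite: Balaban1985BackgroundPropagators, (3.40) p.397, (3.115) p.418, (3.132) p.422, bookkeeping] -/
theorem opsYNuStOfRecordV11KSE_eq : opsYNuStOfRecordV11KSE N θ Mstar 𝔯 𝔢 𝔴 𝔈 =
    opsYNuStOfRecordV11ESH N θ Mstar (qKnitOfRecord N θ) (qsKnitOfRecord N θ) (qKnitOfRecord_flat N θ) (qsKnitOfRecord_flat N θ) 𝔯
      (fun x => parSymY x.toKIdx) 𝔢 𝔴 𝔈 := rfl

/-- the plain knit instance as the star constructor over the Hölder-slot layer of the knit letters (`rfl`). [cite: Balaban1985BackgroundPropagators, Thm 3.15 p.432, bookkeeping] -/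
theorem opsYStOfRecordV11KSE_eq_opsYSectESt : opsYStOfRecordV11KSE N θ Mstar 𝔯 𝔢 𝔴 𝔈 =
    opsYSectESt N θ Mstar (opsYS349OfLettersH N θ Mstar (lettersYOfRecordV11K N θ Mstar 𝔯) (fun x => parSymY x.toKIdx) 𝔈)
      (lettersYOfRecordV11K N θ Mstar 𝔯) 𝔢 𝔴 := rfl

/-- the `ν`-read knit instance as the star constructor over the Hölder-slot layer of the knit letters (`rfl`).
[cite: Balaban1985BackgroundPropagators, Thm 3.15 p.432, (3.132) p.422, bookkeeping] -/
theorem opsYNuStOfRecordV11KSE_eq_opsYSectESt : opsYNuStOfRecordV11KSE N θ Mstar 𝔯 𝔢 𝔴 𝔈 =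
    opsYSectESt N θ Mstar (opsYS349NuOfLettersH N θ Mstar (lettersYOfRecordV11K N θ Mstar 𝔯) (fun x => parSymY x.toKIdx) 𝔈)
      (lettersYOfRecordV11K N θ Mstar 𝔯) 𝔢 𝔴 := rfl

/-- ★★★ LEAF PIN `hGpPin` AT THE OBJECT OF RECORD: `kernelFamilyS … (G′(parKnitY x)) (parSymY x)` — split shape `(parA, parH) = (parKnitY, parSymY)`.
[cite: Balaban1985BackgroundPropagators, Thm 3.1 (3.41)–(3.45) pp.397–398, (3.40) p.397] [cite: Balaban1985Averaging, Prop. 2 p.26] -/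
theorem opsYNuStOfRecordV11KSE_GpPin (x : MemberY θ.d₆ θ.ℓ₆ θ.hd' θ.hL' θ.b₀ θ.b₁ Mstar) :
    kernelFamilyR R₁ R₂ (opsYNuStOfRecordV11KSE N θ Mstar 𝔯 𝔢 𝔴 𝔈 x).Gp =
      kernelFamilyS x.toKIdx (bg9YR (Matrix (Fin N) (Fin N) ℂ) (specialUnitaryUnits (Fin N)) R₁ R₂ x) (fun U => U)
        (GpY x.toKIdx (parKnitY x.toKIdx)) (parSymY x.toKIdx) := rfl

/-- ★★★ LEAF PIN `hGAPin` AT THE OBJECT OF RECORD: `OA := G[QknitY](parKnitY, G′_latt)` with bond transporter `parBY`.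
[cite: Balaban1985BackgroundPropagators, Thm 3.3 (3.51)–(3.56) pp.399–400, (3.27) p.395, (3.115) p.418] [cite: Balaban1985Averaging, (15) p.19] -/
theorem opsYNuStOfRecordV11KSE_GAPin (x : MemberY θ.d₆ θ.ℓ₆ θ.hd' θ.hL' θ.b₀ θ.b₁ Mstar) :
    kernelFamilyR R₁ R₂ (opsYNuStOfRecordV11KSE N θ Mstar 𝔯 𝔢 𝔴 𝔈 x).GA =
      kernelFamilyB x.toKIdx (bg9YR (Matrix (Fin N) (Fin N) ℂ) (specialUnitaryUnits (Fin N)) R₁ R₂ x) (fun U => U)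
        (GAQY x.toKIdx (qKnitOfRecord N θ x.toKIdx) (qsKnitOfRecord N θ x.toKIdx) (parKnitY x.toKIdx) (GpY x.toKIdx (parKnitY x.toKIdx)))
        (parBY x.toKIdx) := rfl

/-- ★ the same pin with `OA := G[QknitY](parKnitY, G′_phys)`. [cite: Balaban1985BackgroundPropagators, Thm 3.3 p.399, (3.25)–(3.27) pp.394–395] -/
theorem opsYNuStOfRecordV11KSE_GAPin_phys (x : MemberY θ.d₆ θ.ℓ₆ θ.hd' θ.hL' θ.b₀ θ.b₁ Mstar) :
    kernelFamilyR R₁ R₂ (opsYNuStOfRecordV11KSE N θ Mstar 𝔯 𝔢 𝔴 𝔈 x).GA =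
      kernelFamilyB x.toKIdx (bg9YR (Matrix (Fin N) (Fin N) ℂ) (specialUnitaryUnits (Fin N)) R₁ R₂ x) (fun U => U)
        (GAQY x.toKIdx (qKnitOfRecord N θ x.toKIdx) (qsKnitOfRecord N θ x.toKIdx) (parKnitY x.toKIdx) (GpPhysY x.toKIdx (parKnitY x.toKIdx)))
        (parBY x.toKIdx) :=
  opsYNuStOfRecordV11ESH_GAPin_phys N θ Mstar (qKnitOfRecord N θ) (qsKnitOfRecord N θ) (qKnitOfRecord_flat N θ) (qsKnitOfRecord_flat N θ) 𝔯
    (fun x => parSymY x.toKIdx) 𝔢 𝔴 𝔈 R₁ R₂ x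

/-- ★★★ LEAF PIN `hCinvPin` AT THE OBJECT OF RECORD: the re-based `Cinv` IS the block kernel of `C(U; parKnitY, G′(parKnitY))`.
[cite: Balaban1985BackgroundPropagators, Thm 3.2 (3.48) p.398] [cite: Balaban1985Averaging, Prop. 2 p.26] -/
theorem opsYNuStOfRecordV11KSE_CinvPin (x : MemberY θ.d₆ θ.ℓ₆ θ.hd' θ.hL' θ.b₀ θ.b₁ Mstar) :
    siteKernelR R₁ R₂ (opsYNuStOfRecordV11KSE N θ Mstar 𝔯 𝔢 𝔴 𝔈 x).Cinv =
      siteKernelOfOp x.toKIdx (bg9YR (Matrix (Fin N) (Fin N) ℂ) (specialUnitaryUnits (Fin N)) R₁ R₂ x) (fun U => U)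
        (CY x.toKIdx (parKnitY x.toKIdx) (GpY x.toKIdx (parKnitY x.toKIdx))) (β x.hN x.D x.hk) (β x.hN x.D x.hk) := rfl

/-- ★★★ THE (3.49) SLOT AT THE OBJECT OF RECORD: `P = I − R(U)` over the KNIT averaging transporter `parKnitY x` and `G′(parKnitY x)` (`rfl`).
[cite: Balaban1985BackgroundPropagators, (3.49) p.399 with (3.21) p.393, (3.115) p.418] [cite: Balaban1985Averaging, (15) p.19] -/
theorem opsYNuStOfRecordV11KSE_P349 (x : MemberY θ.d₆ θ.ℓ₆ θ.hd' θ.hL' θ.b₀ θ.b₁ Mstar) :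
    (opsYNuStOfRecordV11KSE N θ Mstar 𝔯 𝔢 𝔴 𝔈 x).P349 =
      fineKernelOfSiteOp x.toKIdx (bg9Y (Matrix (Fin N) (Fin N) ℂ) (specialUnitaryUnits (Fin N)) x) (fun U => U)
        (P349Y x.toKIdx (parKnitY x.toKIdx) (GpY x.toKIdx (parKnitY x.toKIdx))) := rfl

/-- off the `G′` slot the `ν`-read knit instance IS the v11 knit instance of record `opsYNuStOfRecordV11KE`, operator letters — so every
`opsYNuStOfRecordV11KE_… ∕ opsYNuStOfRecordV11E_…` face off `Gp` transports (the §2 transport at the knit pair). [cite: Balaban1985BackgroundPropagators, Thms 3.2–3.14 pp.398–427, bookkeeping] -/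
theorem opsYNuStOfRecordV11KSE_offGp (x : MemberY θ.d₆ θ.ℓ₆ θ.hd' θ.hL' θ.b₀ θ.b₁ Mstar) :
    (opsYNuStOfRecordV11KSE N θ Mstar 𝔯 𝔢 𝔴 𝔈 x).GA = (opsYNuStOfRecordV11KE N θ Mstar 𝔯 𝔢 𝔴 𝔈 x).GA ∧
      (opsYNuStOfRecordV11KSE N θ Mstar 𝔯 𝔢 𝔴 𝔈 x).Cinv = (opsYNuStOfRecordV11KE N θ Mstar 𝔯 𝔢 𝔴 𝔈 x).Cinv ∧
      (opsYNuStOfRecordV11KSE N θ Mstar 𝔯 𝔢 𝔴 𝔈 x).P349 = (opsYNuStOfRecordV11KE N θ Mstar 𝔯 𝔢 𝔴 𝔈 x).P349 ∧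
      (opsYNuStOfRecordV11KSE N θ Mstar 𝔯 𝔢 𝔴 𝔈 x).QGQinv = (opsYNuStOfRecordV11KE N θ Mstar 𝔯 𝔢 𝔴 𝔈 x).QGQinv ∧
      (opsYNuStOfRecordV11KSE N θ Mstar 𝔯 𝔢 𝔴 𝔈 x).QG1Qinv = (opsYNuStOfRecordV11KE N θ Mstar 𝔯 𝔢 𝔴 𝔈 x).QG1Qinv ∧
      (opsYNuStOfRecordV11KSE N θ Mstar 𝔯 𝔢 𝔴 𝔈 x).GD = (opsYNuStOfRecordV11KE N θ Mstar 𝔯 𝔢 𝔴 𝔈 x).GD ∧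
      (opsYNuStOfRecordV11KSE N θ Mstar 𝔯 𝔢 𝔴 𝔈 x).G₁ = (opsYNuStOfRecordV11KE N θ Mstar 𝔯 𝔢 𝔴 𝔈 x).G₁ ∧
      (opsYNuStOfRecordV11KSE N θ Mstar 𝔯 𝔢 𝔴 𝔈 x).H = (opsYNuStOfRecordV11KE N θ Mstar 𝔯 𝔢 𝔴 𝔈 x).H ∧
      (opsYNuStOfRecordV11KSE N θ Mstar 𝔯 𝔢 𝔴 𝔈 x).H₁ = (opsYNuStOfRecordV11KE N θ Mstar 𝔯 𝔢 𝔴 𝔈 x).H₁ ∧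
      (opsYNuStOfRecordV11KSE N θ Mstar 𝔯 𝔢 𝔴 𝔈 x).GG = (opsYNuStOfRecordV11KE N θ Mstar 𝔯 𝔢 𝔴 𝔈 x).GG ∧
      (opsYNuStOfRecordV11KSE N θ Mstar 𝔯 𝔢 𝔴 𝔈 x).Kdiff = (opsYNuStOfRecordV11KE N θ Mstar 𝔯 𝔢 𝔴 𝔈 x).Kdiff ∧
      (opsYNuStOfRecordV11KSE N θ Mstar 𝔯 𝔢 𝔴 𝔈 x).Ck = (opsYNuStOfRecordV11KE N θ Mstar 𝔯 𝔢 𝔴 𝔈 x).Ck :=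
  opsYNuStOfRecordV11ESH_offGp N θ Mstar (qKnitOfRecord N θ) (qsKnitOfRecord N θ) (qKnitOfRecord_flat N θ) (qsKnitOfRecord_flat N θ) 𝔯
    (fun x => parSymY x.toKIdx) 𝔢 𝔴 𝔈 x

/-- off the `G′` slot the `ν`-read knit instance IS `opsYNuStOfRecordV11KE`, exponent letters and predicates (the §2 transport at the knit pair).
[cite: Balaban1985BackgroundPropagators, Thms 3.4–3.15 pp.400–432, bookkeeping] -/
theorem opsYNuStOfRecordV11KSE_preds (x : MemberY θ.d₆ θ.ℓ₆ θ.hd' θ.hL' θ.b₀ θ.b₁ Mstar) :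
    (opsYNuStOfRecordV11KSE N θ Mstar 𝔯 𝔢 𝔴 𝔈 x).IsAnalyticExt = (opsYNuStOfRecordV11KE N θ Mstar 𝔯 𝔢 𝔴 𝔈 x).IsAnalyticExt ∧
      (opsYNuStOfRecordV11KSE N θ Mstar 𝔯 𝔢 𝔴 𝔈 x).E37 = (opsYNuStOfRecordV11KE N θ Mstar 𝔯 𝔢 𝔴 𝔈 x).E37 ∧
      (opsYNuStOfRecordV11KSE N θ Mstar 𝔯 𝔢 𝔴 𝔈 x).EK39 = (opsYNuStOfRecordV11KE N θ Mstar 𝔯 𝔢 𝔴 𝔈 x).EK39 ∧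
      (opsYNuStOfRecordV11KSE N θ Mstar 𝔯 𝔢 𝔴 𝔈 x).E310 = (opsYNuStOfRecordV11KE N θ Mstar 𝔯 𝔢 𝔴 𝔈 x).E310 ∧
      (opsYNuStOfRecordV11KSE N θ Mstar 𝔯 𝔢 𝔴 𝔈 x).PosDef = (opsYNuStOfRecordV11KE N θ Mstar 𝔯 𝔢 𝔴 𝔈 x).PosDef ∧
      (opsYNuStOfRecordV11KSE N θ Mstar 𝔯 𝔢 𝔴 𝔈 x).HasRWExp = (opsYNuStOfRecordV11KE N θ Mstar 𝔯 𝔢 𝔴 𝔈 x).HasRWExp ∧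
      (opsYNuStOfRecordV11KSE N θ Mstar 𝔯 𝔢 𝔴 𝔈 x).HasRWExpH = (opsYNuStOfRecordV11KE N θ Mstar 𝔯 𝔢 𝔴 𝔈 x).HasRWExpH ∧
      (opsYNuStOfRecordV11KSE N θ Mstar 𝔯 𝔢 𝔴 𝔈 x).PosDefK = (opsYNuStOfRecordV11KE N θ Mstar 𝔯 𝔢 𝔴 𝔈 x).PosDefK ∧
      (opsYNuStOfRecordV11KSE N θ Mstar 𝔯 𝔢 𝔴 𝔈 x).GivenBy3185 = (opsYNuStOfRecordV11KE N θ Mstar 𝔯 𝔢 𝔴 𝔈 x).GivenBy3185 ∧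
      (opsYNuStOfRecordV11KSE N θ Mstar 𝔯 𝔢 𝔴 𝔈 x).HasRWExpC = (opsYNuStOfRecordV11KE N θ Mstar 𝔯 𝔢 𝔴 𝔈 x).HasRWExpC :=
  opsYNuStOfRecordV11ESH_preds N θ Mstar (qKnitOfRecord N θ) (qsKnitOfRecord N θ) (qKnitOfRecord_flat N θ) (qsKnitOfRecord_flat N θ) 𝔯
    (fun x => parSymY x.toKIdx) 𝔢 𝔴 𝔈 x

/-- ★ LEAF PINS and the (3.49) slot at the PLAIN knit instance (same right-hand sides). [cite: Balaban1985BackgroundPropagators, Thms 3.1–3.3 pp.397–400, (3.49) p.399] -/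
theorem opsYStOfRecordV11KSE_pins (x : MemberY θ.d₆ θ.ℓ₆ θ.hd' θ.hL' θ.b₀ θ.b₁ Mstar) :
    kernelFamilyR R₁ R₂ (opsYStOfRecordV11KSE N θ Mstar 𝔯 𝔢 𝔴 𝔈 x).Gp =
        kernelFamilyS x.toKIdx (bg9YR (Matrix (Fin N) (Fin N) ℂ) (specialUnitaryUnits (Fin N)) R₁ R₂ x) (fun U => U)
          (GpY x.toKIdx (parKnitY x.toKIdx)) (parSymY x.toKIdx) ∧
      kernelFamilyR R₁ R₂ (opsYStOfRecordV11KSE N θ Mstar 𝔯 𝔢 𝔴 𝔈 x).GA =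
        kernelFamilyB x.toKIdx (bg9YR (Matrix (Fin N) (Fin N) ℂ) (specialUnitaryUnits (Fin N)) R₁ R₂ x) (fun U => U)
          (GAQY x.toKIdx (qKnitOfRecord N θ x.toKIdx) (qsKnitOfRecord N θ x.toKIdx) (parKnitY x.toKIdx) (GpY x.toKIdx (parKnitY x.toKIdx)))
          (parBY x.toKIdx) ∧
      siteKernelR R₁ R₂ (opsYStOfRecordV11KSE N θ Mstar 𝔯 𝔢 𝔴 𝔈 x).Cinv =
        siteKernelOfOp x.toKIdx (bg9YR (Matrix (Fin N) (Fin N) ℂ) (specialUnitaryUnits (Fin N)) R₁ R₂ x) (fun U => U)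
          (CY x.toKIdx (parKnitY x.toKIdx) (GpY x.toKIdx (parKnitY x.toKIdx))) (β x.hN x.D x.hk) (β x.hN x.D x.hk) ∧
      (opsYStOfRecordV11KSE N θ Mstar 𝔯 𝔢 𝔴 𝔈 x).P349 =
        fineKernelOfSiteOp x.toKIdx (bg9Y (Matrix (Fin N) (Fin N) ℂ) (specialUnitaryUnits (Fin N)) x) (fun U => U)
          (P349Y x.toKIdx (parKnitY x.toKIdx) (GpY x.toKIdx (parKnitY x.toKIdx))) := ⟨rfl, rfl, rfl, rfl⟩

/-- ☆ FOR THE RECORD: edition 2's knit instance `opsYNuStOfRecordV11KHE` reads `parSymY` inside `R(U)` of (3.49) (`rfl`) — the reason this edition exists.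
[cite: Balaban1985BackgroundPropagators, (3.49) p.399 with (3.21) p.393, (3.40) p.397] -/
theorem opsYNuStOfRecordV11KHE_P349 (x : MemberY θ.d₆ θ.ℓ₆ θ.hd' θ.hL' θ.b₀ θ.b₁ Mstar) :
    (opsYNuStOfRecordV11KHE N θ Mstar 𝔯 𝔢 𝔴 𝔈 x).P349 =
      fineKernelOfSiteOp x.toKIdx (bg9Y (Matrix (Fin N) (Fin N) ℂ) (specialUnitaryUnits (Fin N)) x) (fun U => U)
        (P349Y x.toKIdx (parSymY x.toKIdx) (GpY x.toKIdx (parKnitY x.toKIdx))) := rfl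

end RecordKnit

end

end Literature.MathematicalPhysics.QuantumFieldTheory.Balaban1983to89.Node00
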